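import Literature.MathematicalPhysics.QuantumFieldTheory.Balaban1983to89.Node00.CarriersZSectE
import Literature.MathematicalPhysics.QuantumFieldTheory.Balaban1983to89.Node00.CriticalOfRecord
import Literature.MathematicalPhysics.QuantumFieldTheory.Balaban1983to89.B11Reg910Classes

/-!
# NODE 00 (YM-PLAN Track A) — THE SOUNDNESS LAW OF THE RESIDUAL REGULARITY DATA of the [Balaban1985Variational] group of record: when a residual layer's
# regularity datum `ζ.R` says «gauged» at `(U, □)`, its five numbers READ AN ACTUAL GAUGE on `□` — so that the typed regularity clause of Theorem 1 at
# NODE 00's objects GIVES print's (9)–(10) in their ∃u-form (`B11Reg910Classes.Reg910T`) and the consumed currency [Balaban1985BackgroundPropagators]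
# (3.35)–(3.36) (`Reg336Cube`) BY NAME; the law rides through both pins of record (`withSectE`, `pinCrit`); what it does not do, said

NODE 00 CARRIER MODULE (seat `pub-ymgap-node00-def-B11` g3, 2026-08-26; director-ym R141 (A) row «is `CarriersZ` the B11 pin?» — ANSWER OF RECORD: IT IS
(`Node00/CarriersZ.lean`, bundle `Z11OfRecord F N ζ`, keys `IsRecordOfRecord₉∕₁₀∕₁₁CB10YZ(W)`); this module is the SECOND COMPANION that answer names (after g2's
`Node00/CarriersZSectE.lean`), on interface finding F8 — the regularity data `R` — and is NOT a pin of `R`, NOT a second bundle, NOT a record key).  APPEND-ONLY: a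
NEW importing module; `CarriersZ`, `CarriersZSectE`, n07-e's `CriticalOfRecord`, n07-a's `B11Thm1CarrierT`, n05-e's `B11Reg910Classes` ∕ `B9Eq335RegularityClasses`
are untouched and CONSUMED BY NAME.  [Balaban1985Variational] = T. Bałaban, *The variational problem and background fields in renormalization group method for
lattice gauge theories*, Commun. Math. Phys. **102** (1985) 277–309 (cell paper B11); [Balaban1985BackgroundPropagators] = CMP **99** (1985) 389–434 (B9);
[Balaban1985RegularSpaces] = CMP **99** (1985) 75–102 (B8).

WHY.  In n07-a's native carrier `B11Thm1CarrierT.RegCarrierT F N K` — the data the typed Theorem 1 `B11Thm1.Thm1At` reads through `varProblemT` — the regularity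
conclusion (9)–(10) is the typed clause `B11.Regularity`: «`R.Gauged U □` and the numbers `R.normA U □`, `R.normGradA U □`, `R.holderA U □ β`, `R.normLapA U □` lie
below print's thresholds `B₃Mε₁ξ⁻¹`, `B₃Mε₁ξ⁻²`, `B₄Mε₁ξ^{-(2+β)}`, `B₃Mε₁ξ⁻³» (`ξ = Lʲη`).  Those numbers are FREE DATA: nothing ties them to a gauge transformation
`u` and a potential `A` with `Uᵘ = e^{iηA}` on `□`, which is what (9)–(10) SAY (p. 279: «there exists a gauge transformation u defined on a neighborhood of □ and such
that on □ Uᵘ = e^{iηA}, |A|, |∇^η A| < B₃Mε₁(Lʲη)⁻¹⁽²⁾, …»).  Interface finding F8 (g0) recorded that an OBJECT-LEVEL PIN of `R` needs [Balaban1985RegularSpaces]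
Thm 2's gauge as a MAP on NODE 00's gauge fields — not in the tree on T⁴ (ℤᵈ prototypes `B8LeafModelZd3Thm2Of135.thm2_of135_zd3_univ`, `B8Eq138LandauZd`; typer
[B11]'s T³ twin `T3SectALandauChart.Resid` carries the corresponding operators as presentation parameters without torus body) — and is unowned.  THIS MODULE TYPES
THE HALF OF F8 THAT IS TYPABLE TODAY: the SOUNDNESS LAW every such pin must satisfy, and its faces — at a law-abiding datum the typed clause IMPLIES print's sentence.

DESIGN FACT OF RECORD (why a law and not a pin).  At fixed `(U, □)` the truth set of the typed clause in the threshold plane `(t₁, t₂) = (B₃Mε₁, B₄Mε₁)` is an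
UPPER ORTHANT cut out by the datum's numbers (each member reads «number < tₙ·ξ⁻ⁿ»), whereas the truth set of print's ∃u-sentence is a UNION OVER GAUGES `u` of such
orthants — in general not an orthant.  Hence NO gauge-free choice of the five numbers makes `B11.Regularity (varProblemT F N K k R) B₃ B₄ ε₁ U □ ↔ Reg910T …` hold
for all thresholds: every faithful pin is GAUGE-FIXED (print's own is the gauge `U₁ = e^{iηA}` of Sect. F (159), pp. 303–305, built on [Balaban1985RegularSpaces]
Thm 2, p. 83), and the per-member infimum over gauges, though complete, is UNSOUND (the members would be read in different gauges, while the consumer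
[Balaban1985BackgroundPropagators] (3.35) needs ONE `u`).  What can be certified gauge-independently is exactly ONE direction — soundness — and that is this module.

WHAT.  §1 (generic, over n05-e's one-cube classes: structure maps `T`, a units-valued bond field `U` of a complete normed ℂ-algebra `𝔸`): `ReadsGaugeCube T U η □ dist
nA nG nH nL` = «∃ (`u` of unitary type on `□`) (`A`), `Uᵘ = e^{iηA}` on `□` and `|A| ≤ nA`, `|∇^η A| ≤ nG`, Hölder quotients `≤ nH β`, `|∂^{η*}∂^η A|, |Δ^η A| ≤ nL` on
`□`» (= `Reg910Cube`'s body with «< Cξ⁻ⁿ» replaced by «≤ the number»); `reg910Cube_of_readsGaugeCube` (numbers below thresholds ⇒ `Reg910Cube`, `β₀ ≤ 1`);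
non-vacuity `readsGaugeCube_one_zero` (`U = 1`: `u = 1`, `A = 0`, read by zeros); TEETH `gaugeTr_eq_one_of_readsGaugeCube_nonpos` (`nA ≤ 0` ⇒ `U` is PURE GAUGE on
`□`).  §2 (at NODE 00's objects: fibre `M_N(ℂ)` via `toPV`, structure maps `shiftEquiv` of the finest torus `Site (F.P K) 0`, `η := (F.P K).eta k`): `RegGeomT F N K R`
(a READING of the datum's abstract cubes as site sets plus the η-scale distance — DATA: the geometry n07-a's `Cube : Type` abstracts, reading D-n07a-4); the law
`RegReadsGauge k R g`; the SOUNDNESS FACES `reg910T_of_regularity` (typed clause at a law-abiding datum ⇒ `Reg910T F N K k U (g.carrier □) (R.scale □) g.dist (B₃Mε₁)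
(B₄Mε₁) 1`, thresholds matched LITERALLY: `varProblemT`'s `L^{scale □}·η = scaleLen F.L η (R.scale □)` by `rfl`, `(ξ^{2+β})⁻¹ = ξ⁻¹^{(2+β)}` by `Real.inv_rpow`) and
`reg336Cube_of_regularity` (⇒ [Balaban1985BackgroundPropagators] (3.35)–(3.36) with `O(1)Mα₀ := B₃Mε₁`, n05-e's `Reg910T.reg336Cube`); `regReadsGauge_of_not_gauged`
(a datum that never says «gauged» is law-abiding VACUOUSLY — the law polices soundness, not the junk channel); teeth at objects
`pureGauge_of_regReadsGauge_of_normA_nonpos`; and a law-abiding datum that DOES say «gauged»: `flatRegCarrierT` (`Gauged U □ := U ≡ 1 on □` bondwise, numbers `0`),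
`regReadsGauge_flat`, `flat_gauged_one`.  §3 (on the residual layer): `ResidZ.RegSound ζ g` (every member's datum reads gauges at the member's level); its
invariance under BOTH pins of record (`ResidZ.regSound_withSectE_iff`, `ResidZ.regSound_pinCrit_iff`, `ResidZ.RegSound.withSectE_pinCrit` — `R` is untouched by g2's
`withSectE` and n07-e's `pinCrit`, `rfl`, so the law holds at the doubly-pinned layer `(ζ.withSectE E).pinCrit` of the N07 closers iff at `ζ`); the HEADLINE
`reg910T_of_b11Leaf_of_regSound`: AT A LAW-ABIDING LAYER THE LEAF `B11Leaf (Z11OfRecord F N ζ)` GIVES THEOREM 1's (9)–(10) AS PRINTED (∃u-form) — every member, every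
`0 < ε₁ ≤ a₁`, every `V` with (7), every minimal `U` of (5) over `𝔘_k(B₃ε₁) ∩ 𝔅_k(V)`, every cube with `M ≤ M(ε₁)` — via `CarriersZ.exists_thm1At_of_b11Leaf_Z11OfRecord`
and §2 (`reg910T_of_b11Leaf_withSectE_pinCrit_of_regSound` = the same at the doubly-pinned layer); and the honesty theorem `exists_regSound_not_b11Leaf`.

WHAT STAYS RESIDUAL ∕ WHAT THIS IS NOT, EXPLICITLY: (a) NOT a pin of `ζ.R`: the law is a PREDICATE on `(ζ, g)`, not a field of `ResidZ` and not a record key —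
record-level use is BY HYPOTHESIS `(hs : ζ.RegSound g)` next to the keys of record (no new key; def-T LOCATED-2: no `₁₁` key), as the N07 closers carry their displayed
hypotheses; (b) COMPLETENESS (print's sentence ⇒ the typed clause at some law-abiding datum, i.e. the gauge-fixed pin) is NOT here: it needs [Balaban1985RegularSpaces]
Thm 2 ((1.29), (1.36)–(1.39), p. 83) as a map on `GaugeField (F.P K) 0 (SU N)` — unowned, F8 stands HALVED; (c) the JUNK CHANNEL of the ∀-form SURVIVES
(`exists_regSound_not_b11Leaf`: a never-«gauged» datum is vacuously law-abiding and still fails the leaf through `t1`, cf. `CarriersZ.exists_residZ_not_b11Leaf`,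
`CarriersZSectE.exists_withSectE_not_b11Leaf`) — closing it is the completeness half; (d) `ζ.IsCrit` is n07-e's (`CriticalOfRecord.IsCritOfRecord`, pinned by
`pinCrit`), `ζ.famAn` (Sect. G) stays residual; (e) the cube geometry `g : RegGeomT` is the consumer's datum (of record: print's cubes `□ ⊂ B_j(Λ_j) ∪ B_{j+1}(Λ_{j+1})`
of size `2MLʲη`, p. 279, and the η-lattice distance — NODE 00 has not typed them as site sets; `RegGeomT` is the slot a future pin fills).
HONEST FRAMING: definitions + kernel bookkeeping (monotonicity `≤ ⋯ < `, two `rfl`s, one `Real.inv_rpow`); NO estimate; nothing of [Balaban1985Variational] asserted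
or proved; N07 NOT discharged, no count moved; one finite T⁴ programme at fixed ε — NOT continuum ∕ ℝ⁴ ∕ infinite volume ∕ OS ∕ mass gap ∕ Clay.  No `sorry`, no
`axiom`, no `opaque`, no `instance`, no `notation`.  Filed `--supports stmt-QuantumFields-19673` (K0). -/

noncomputable section

open scoped Matrix.Norms.L2Operator

namespace Literature.MathematicalPhysics.QuantumFieldTheory.Balaban1983to89.Node00

open T4Continuum AveragingRT T4FiniteEpsInhabited FlowStep FlowStepRuns DagBinding T4DatumAssembly
open B9Eq39Adjoint (covD covDstar curlη divPη fluct)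
open B9Eq3117Current (gaugeTr)
open B9Eq335RegularityClasses (Reg336Cube)
open B11Reg910Classes (lapη Reg910Cube Reg910T toPV)
open B11Thm1 (Thm1At)
open B11Thm1CarrierT (RegCarrierT varProblemT)
open LatticeNorms (scaleLen)

/-! ## §1. Generic: five numbers READ an actual gauge on one cube -/

section Generic

variable {𝔸 : Type*} [NormedRing 𝔸] [NormedAlgebra ℂ 𝔸] [CompleteSpace 𝔸] {S : Type*} {ι : Type*} [Fintype ι] [LinearOrder ι]
variable (T : ι → Equiv.Perm S) (U : ι → S → 𝔸ˣ)

/-- **FIVE NUMBERS READ A GAUGE ON `□`**: the numbers `nA, nG, nH β, nL` DOMINATE the norms `|A|`, `|∇^η A|`, the `β`-Hölder quotients of `∇^η A` (`0 ≤ β ≤ 1`,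
η-scale distance `≤ 1`), `|∂^{η*}∂^η A|` and `|Δ^η A|` on `□` of the potential `A` of SOME gauge transformation `u` of unitary type on `□` with `Uᵘ = e^{iηA}` on `□`
— the body of n05-e's `B11Reg910Classes.Reg910Cube` with each «`< C ξ⁻ⁿ`» replaced by «`≤` the number».
[cite: Balaban1985Variational, Thm 1 (9)–(10) p.279 («there exists a gauge transformation u … such that on □ Uᵘ = e^{iηA}, |A|, |∇^η A| < …»)] -/
def ReadsGaugeCube (η : ℝ) (cube : Set S) (dist : S → S → ℝ) (nA nG : ℝ) (nH : ℝ → ℝ) (nL : ℝ) : Prop :=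
  ∃ (u : S → 𝔸ˣ) (A : ι → S → 𝔸),
    (∀ z ∈ cube, ‖(u z : 𝔸)‖ ≤ 1 ∧ ‖(((u z)⁻¹ : 𝔸ˣ) : 𝔸)‖ ≤ 1) ∧
    (∀ κ, ∀ z ∈ cube, gaugeTr T u U κ z = fluct η A κ z) ∧
    (∀ κ, ∀ z ∈ cube, ‖A κ z‖ ≤ nA) ∧
    (∀ κ ν, ∀ z ∈ cube, ‖((η : ℂ)⁻¹) • covD T (fun _ _ => (1 : 𝔸ˣ)) κ (A ν) z‖ ≤ nG) ∧
    (∀ β : ℝ, 0 ≤ β → β ≤ 1 → ∀ κ ν, ∀ z ∈ cube, ∀ z' ∈ cube, 0 < dist z z' → dist z z' ≤ 1 →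
      ‖((η : ℂ)⁻¹) • covD T (fun _ _ => (1 : 𝔸ˣ)) κ (A ν) z' - ((η : ℂ)⁻¹) • covD T (fun _ _ => (1 : 𝔸ˣ)) κ (A ν) z‖ ≤
        nH β * dist z z' ^ β) ∧
    (∀ μ, ∀ z ∈ cube, ‖divPη T (fun _ _ => (1 : 𝔸ˣ)) η (curlη T (fun _ _ => (1 : 𝔸ˣ)) η A) μ z‖ ≤ nL) ∧
    (∀ κ, ∀ z ∈ cube, ‖lapη T (fun _ _ => (1 : 𝔸ˣ)) η (A κ) z‖ ≤ nL)

variable {T U}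

/-- **SOUNDNESS ON ONE CUBE**: numbers that read a gauge on `□` and lie below print's thresholds `Cξ⁻¹`, `Cξ⁻²`, `C₄ξ^{-(2+β)}` (`0 ≤ β ≤ β₀ ≤ 1`), `Cξ⁻³` give
(9)–(10) on `□` in their ∃u-form `Reg910Cube` (monotonicity `≤ ⋯ <`; the Hölder member uses `0 < dist z z'`).
[cite: Balaban1985Variational, Thm 1 (9)–(10) p.279] -/
theorem reg910Cube_of_readsGaugeCube {η : ℝ} {cube : Set S} {dist : S → S → ℝ} {nA nG : ℝ} {nH : ℝ → ℝ} {nL : ℝ}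
    (h : ReadsGaugeCube T U η cube dist nA nG nH nL) {ξ C C₄ β₀ : ℝ} (hβ₀ : β₀ ≤ 1)
    (hA : nA < C * ξ⁻¹) (hG : nG < C * (ξ ^ 2)⁻¹) (hH : ∀ β : ℝ, 0 ≤ β → β ≤ β₀ → nH β < C₄ * (ξ ^ (2 + β))⁻¹)
    (hL : nL < C * (ξ ^ 3)⁻¹) : Reg910Cube T U η cube ξ dist C C₄ β₀ := by
  obtain ⟨u, A, hu, hg, h1, h2, h3, h4, h5⟩ := h
  refine ⟨u, A, hu, hg, fun κ z hz => (h1 κ z hz).trans_lt hA, fun κ ν z hz => (h2 κ ν z hz).trans_lt hG,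
    fun β hβ hββ₀ κ ν z hz z' hz' hd hd1 => ?_, fun μ z hz => (h4 μ z hz).trans_lt hL, fun κ z hz => (h5 κ z hz).trans_lt hL⟩
  exact (h3 β hβ (hββ₀.trans hβ₀) κ ν z hz z' hz' hd hd1).trans_lt
    (mul_lt_mul_of_pos_right (hH β hβ hββ₀) (Real.rpow_pos_of_pos hd β))

/-- **NON-VACUITY OF THE READING**: at the trivial configuration `U = 1` the numbers `0, 0, 0, 0` read the gauge `u = 1`, `A = 0` (n05-e's `covD_zero`,
`covDstar_zero`, `lapη_zero` by name). [cite: Balaban1985Variational, Thm 1 (9)–(10) p.279 (the configuration `U = 1`, `A = 0`)] -/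
theorem readsGaugeCube_one_zero [NormOneClass 𝔸] (η : ℝ) (cube : Set S) (dist : S → S → ℝ) :
    ReadsGaugeCube T (fun _ _ => (1 : 𝔸ˣ)) η cube dist 0 0 (fun _ => 0) 0 := by
  have hcovD : ∀ κ, covD T (fun _ _ => (1 : 𝔸ˣ)) κ (fun _ : S => (0 : 𝔸)) = fun _ => 0 :=
    fun κ => funext (B11Reg910Classes.covD_zero T _ κ)
  have hcurl : curlη T (fun _ _ => (1 : 𝔸ˣ)) η (fun (_ : ι) (_ : S) => (0 : 𝔸)) = fun _ _ _ => 0 := by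
    funext μ ν x
    simp [curlη, B9Eq39Adjoint.curl, hcovD]
  have hdivP : ∀ μ z, divPη T (fun _ _ => (1 : 𝔸ˣ)) η (fun (_ : ι) (_ : ι) (_ : S) => (0 : 𝔸)) μ z = 0 := by
    intro μ z
    simp [divPη, B9Eq39Adjoint.divP, B11Reg910Classes.covDstar_zero]
  refine ⟨fun _ => 1, fun _ _ => 0, fun z _ => ?_, fun κ z _ => ?_, fun κ z _ => ?_, fun κ ν z _ => ?_,
    fun β _ _ κ ν z _ z' _ hd _ => ?_, fun μ z _ => ?_, fun κ z _ => ?_⟩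
  · simp
  · ext
    simp [gaugeTr, fluct]
  · simp
  · rw [show (fun _ : S => (0 : 𝔸)) = fun _ => 0 from rfl, hcovD, smul_zero, norm_zero]
  · rw [hcovD, smul_zero, sub_self, norm_zero]
    exact mul_nonneg le_rfl (Real.rpow_nonneg hd.le _)
  · rw [hcurl, hdivP, norm_zero]
  · rw [B11Reg910Classes.lapη_zero, norm_zero]

/-- **THE LAW HAS TEETH**: numbers with `nA ≤ 0` that read a gauge force `U` to be PURE GAUGE on `□` — `Uᵘ = 1` there for a `u` of unitary type on `□`
(`|A| ≤ 0 ⇒ A = 0 ⇒ e^{iηA} = 1`). [cite: Balaban1985Variational, Thm 1 (9)–(10) p.279 (`Uᵘ = e^{iηA}`)] -/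
theorem gaugeTr_eq_one_of_readsGaugeCube_nonpos {η : ℝ} {cube : Set S} {dist : S → S → ℝ} {nA nG : ℝ} {nH : ℝ → ℝ} {nL : ℝ}
    (h : ReadsGaugeCube T U η cube dist nA nG nH nL) (hA : nA ≤ 0) :
    ∃ u : S → 𝔸ˣ, (∀ z ∈ cube, ‖(u z : 𝔸)‖ ≤ 1 ∧ ‖(((u z)⁻¹ : 𝔸ˣ) : 𝔸)‖ ≤ 1) ∧ ∀ κ, ∀ z ∈ cube, gaugeTr T u U κ z = 1 := by
  obtain ⟨u, A, hu, hg, h1, -, -, -, -⟩ := h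
  refine ⟨u, hu, fun κ z hz => ?_⟩
  have hA0 : A κ z = 0 := norm_le_zero_iff.mp ((h1 κ z hz).trans hA)
  rw [hg κ z hz]
  ext
  simp [fluct, hA0]

end Generic

/-! ## §2. The law at NODE 00's objects: a regularity datum READS GAUGES -/

section Record

variable (F : T4Family) (N : ℕ) [NeZero N]

/-- **A GEOMETRIC READING of the abstract cube class of a regularity datum** on the finest torus of the `K`-th approximation: each abstract cube `□ : R.Cube`
as a SET OF SITES, and the η-scale lattice distance entering the Hölder member (reading D-n07a-4 — n07-a's `RegCarrierT.Cube` is an abstract type; the cubes of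
print are `□ ⊂ B_j(Λ_j) ∪ B_{j+1}(Λ_{j+1})` of size `2MLʲη`).  DATA, no law: the slot a future object-level pin of `R` fills.
[cite: Balaban1985Variational, p.279 («We consider all cubes □ satisfying the above conditions»)] -/
structure RegGeomT (K : ℕ) (R : RegCarrierT F N K) where
  /-- the cube `□` as a set of sites of the finest torus -/
  carrier : R.Cube → Set (Site (F.P K) 0)
  /-- the η-scale lattice distance entering the Hölder member of (9) -/
  dist : Site (F.P K) 0 → Site (F.P K) 0 → ℝ

variable {F N}

/-- **THE SOUNDNESS LAW OF A REGULARITY DATUM at level `k`**: whenever the datum says «gauged» at `(U, □)`, its five numbers `normA U □`, `normGradA U □`,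
`holderA U □`, `normLapA U □` READ AN ACTUAL GAUGE on the site set `g.carrier □` — fibre algebra `M_N(ℂ)` (`SU N ⊆ M_N(ℂ)`, `toPV`), structure maps the unit
translations `shiftEquiv` of the finest torus, `η := (F.P K).eta k = L^{−k}`. [cite: Balaban1985Variational, Thm 1 (9)–(10) p.279] -/
def RegReadsGauge {K : ℕ} (k : ℕ) (R : RegCarrierT F N K) (g : RegGeomT F N K R) : Prop :=
  ∀ (U : GaugeField (F.P K) 0 (SU N)) (c : R.Cube), R.Gauged U c →
    ReadsGaugeCube (fun μ => (LatticeFieldCalculus.shiftEquiv μ : Equiv.Perm (Site (F.P K) 0))) (toPV U) ((F.P K).eta k)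
      (g.carrier c) g.dist (R.normA U c) (R.normGradA U c) (R.holderA U c) (R.normLapA U c)

/-- ★ **SOUNDNESS FACE**: at a law-abiding datum, the TYPED regularity clause `B11.Regularity` of Theorem 1 (read through n07-a's `varProblemT`) at `(U, □)` with
thresholds `(B₃, B₄, ε₁)` GIVES print's (9)–(10) on `□` in the ∃u-form `Reg910T`, constants `C := B₃Mε₁`, `C₄ := B₄Mε₁`, `β₀ := 1`, `ξ := Lʲη` — thresholds matched
literally (`varProblemT`'s `L^{scale □}·η = scaleLen F.L η (scale □)` is `rfl`; `(ξ^{2+β})⁻¹ = (ξ⁻¹)^{2+β}` is `Real.inv_rpow`).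
[cite: Balaban1985Variational, Thm 1 (9)–(10) p.279; Sect. F (164)–(169) pp.304–305 (where print derives them, in the gauge of (159))] -/
theorem reg910T_of_regularity {K k : ℕ} {R : RegCarrierT F N K} {g : RegGeomT F N K R} (h : RegReadsGauge k R g)
    {B₃ B₄ ε₁ : ℝ} {U : GaugeField (F.P K) 0 (SU N)} {c : R.Cube} (hr : B11.Regularity (varProblemT F N K k R) B₃ B₄ ε₁ U c) :
    Reg910T F N K k U (g.carrier c) (R.scale c) g.dist (B₃ * R.sizeM c * ε₁) (B₄ * R.sizeM c * ε₁) 1 := by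
  obtain ⟨hG, hA, hD, hH, hL⟩ := hr
  have hLpos : (0 : ℝ) < F.L := by exact_mod_cast lt_trans zero_lt_one F.hL.2
  have hη : 0 < (F.P K).eta k := pow_pos (inv_pos.mpr (Nat.cast_pos.mpr (F.P K).L_pos)) k
  have hξ : 0 < scaleLen (F.L : ℝ) ((F.P K).eta k) (R.scale c) := LatticeNorms.scaleLen_pos hLpos hη _
  have hξeq : (varProblemT F N K k R).L ^ (varProblemT F N K k R).scale c * (varProblemT F N K k R).eta =
      scaleLen (F.L : ℝ) ((F.P K).eta k) (R.scale c) := rfl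
  rw [hξeq] at hA hD hH hL
  refine reg910Cube_of_readsGaugeCube (h U c hG) le_rfl ?_ ?_ ?_ ?_
  · simpa [varProblemT] using hA
  · simpa [varProblemT, inv_pow] using hD
  · intro β hβ hβ1
    have := hH β hβ hβ1
    rw [Real.inv_rpow hξ.le] at this
    simpa [varProblemT] using this
  · simpa [varProblemT, inv_pow] using hL

/-- ★ **THE CONSUMED CURRENCY**: at a law-abiding datum, the typed clause at `(U, □)` gives [Balaban1985BackgroundPropagators] (3.35)–(3.36) on `□` with
`O(1)Mα₀ := B₃Mε₁`, `Lʲη := scaleLen F.L η (scale □)` — n05-e's `Reg910T.reg336Cube` by name.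
[cite: Balaban1985BackgroundPropagators, (3.35)–(3.36) p.396; Balaban1985Variational, Thm 1 (9)–(10) p.279] -/
theorem reg336Cube_of_regularity {K k : ℕ} {R : RegCarrierT F N K} {g : RegGeomT F N K R} (h : RegReadsGauge k R g)
    {B₃ B₄ ε₁ : ℝ} {U : GaugeField (F.P K) 0 (SU N)} {c : R.Cube} (hr : B11.Regularity (varProblemT F N K k R) B₃ B₄ ε₁ U c) :
    Reg336Cube (fun μ => (LatticeFieldCalculus.shiftEquiv μ : Equiv.Perm (Site (F.P K) 0))) (toPV U) ((F.P K).eta k)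
      (g.carrier c) (scaleLen (F.L : ℝ) ((F.P K).eta k) (R.scale c)) (B₃ * R.sizeM c * ε₁) :=
  (reg910T_of_regularity h hr).reg336Cube _ _

omit [NeZero N] in
/-- A datum that NEVER says «gauged» is law-abiding VACUOUSLY: the law polices SOUNDNESS of the numbers at gauged cubes, not the refuting junk channel of the
∀-form (cf. `CarriersZ.exists_residZ_not_b11Leaf`). [cite: Balaban1985Variational, Thm 1 (9)–(10) p.279 (bookkeeping)] -/
theorem regReadsGauge_of_not_gauged {K : ℕ} (k : ℕ) {R : RegCarrierT F N K} (g : RegGeomT F N K R)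
    (h : ∀ U c, ¬ R.Gauged U c) : RegReadsGauge k R g :=
  fun U c hG => absurd hG (h U c)

omit [NeZero N] in
/-- **TEETH AT OBJECTS**: at a law-abiding datum, a gauged `(U, □)` whose `|A|`-number is `≤ 0` has `U` PURE GAUGE on the site set of `□`: `Uᵘ = 1` there for
some `u` of unitary type. [cite: Balaban1985Variational, Thm 1 (9)–(10) p.279 (`Uᵘ = e^{iηA}`)] -/
theorem pureGauge_of_regReadsGauge_of_normA_nonpos {K k : ℕ} {R : RegCarrierT F N K} {g : RegGeomT F N K R} (h : RegReadsGauge k R g)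
    {U : GaugeField (F.P K) 0 (SU N)} {c : R.Cube} (hG : R.Gauged U c) (h0 : R.normA U c ≤ 0) :
    ∃ u : Site (F.P K) 0 → (Matrix (Fin N) (Fin N) ℂ)ˣ,
      (∀ z ∈ g.carrier c, ‖(u z : Matrix (Fin N) (Fin N) ℂ)‖ ≤ 1 ∧ ‖(((u z)⁻¹ : (Matrix (Fin N) (Fin N) ℂ)ˣ) : Matrix (Fin N) (Fin N) ℂ)‖ ≤ 1) ∧
      ∀ κ, ∀ z ∈ g.carrier c, gaugeTr (fun μ => (LatticeFieldCalculus.shiftEquiv μ : Equiv.Perm (Site (F.P K) 0))) u (toPV U) κ z = 1 :=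
  gaugeTr_eq_one_of_readsGaugeCube_nonpos (h U c hG) h0

variable (F N) in
/-- **A LAW-ABIDING DATUM THAT DOES SAY «GAUGED»** (the flat stratum — a DEGENERATE datum, not Bałaban's): abstract cubes `Q` read by `carrier`, `Gauged U □ :=
U ≡ 1 on □` bondwise (through `toPV`), all numbers `0`. [cite: Balaban1985Variational, Thm 1 (9)–(10) p.279 (the configuration `U = 1`)] -/
def flatRegCarrierT (K : ℕ) (Q : Type) (carrier : Q → Set (Site (F.P K) 0)) (scale : Q → ℕ) (sizeM : Q → ℝ) : RegCarrierT F N K where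
  Cube := Q
  scale := scale
  sizeM := sizeM
  Gauged := fun U c => ∀ κ, ∀ z ∈ carrier c, toPV U κ z = 1
  normA := fun _ _ => 0
  normGradA := fun _ _ => 0
  holderA := fun _ _ _ => 0
  normLapA := fun _ _ => 0

/-- The flat datum READS the gauge `u = 1`, `A = 0` on every gauged cube — it is LAW-ABIDING, non-vacuously (§1's `readsGaugeCube_one_zero`; `gaugeTr` reads the
bond field only at the bond `(κ, z)`). [cite: Balaban1985Variational, Thm 1 (9)–(10) p.279 (the configuration `U = 1`, `A = 0`)] -/
theorem regReadsGauge_flat {K : ℕ} (k : ℕ) (Q : Type) (carrier : Q → Set (Site (F.P K) 0)) (scale : Q → ℕ) (sizeM : Q → ℝ)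
    (dist : Site (F.P K) 0 → Site (F.P K) 0 → ℝ) :
    RegReadsGauge k (flatRegCarrierT F N K Q carrier scale sizeM) ⟨carrier, dist⟩ := by
  letI : CStarAlgebra (Matrix (Fin N) (Fin N) ℂ) := B10Eq29TubeLine.cstarAlgebraMatrix N
  intro U c hG
  obtain ⟨u, A, hu, hg, h1, h2, h3, h4, h5⟩ :=
    readsGaugeCube_one_zero (T := fun μ => (LatticeFieldCalculus.shiftEquiv μ : Equiv.Perm (Site (F.P K) 0)))
      (𝔸 := Matrix (Fin N) (Fin N) ℂ) ((F.P K).eta k) (carrier c) dist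
  refine ⟨u, A, hu, fun κ z hz => ?_, h1, h2, h3, h4, h5⟩
  have hUz : toPV U κ z = 1 := hG κ z hz
  rw [show gaugeTr (fun μ => (LatticeFieldCalculus.shiftEquiv μ : Equiv.Perm (Site (F.P K) 0))) u (toPV U) κ z =
      gaugeTr (fun μ => (LatticeFieldCalculus.shiftEquiv μ : Equiv.Perm (Site (F.P K) 0))) u
        (fun _ _ => (1 : (Matrix (Fin N) (Fin N) ℂ)ˣ)) κ z from by simp only [gaugeTr, hUz]]
  exact hg κ z hz

/-- … and the flat datum SAYS «gauged» at the trivial configuration on every cube (`toPV_one`): the law is exercised, not vacuous.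
[cite: Balaban1985Variational, Thm 1 (9)–(10) p.279 (the configuration `U = 1`)] -/
theorem flat_gauged_one {K : ℕ} (Q : Type) (carrier : Q → Set (Site (F.P K) 0)) (scale : Q → ℕ) (sizeM : Q → ℝ) (c : Q) :
    (flatRegCarrierT F N K Q carrier scale sizeM).Gauged (1 : GaugeField (F.P K) 0 (SU N)) c := by
  intro κ z _
  rw [B11Reg910Classes.toPV_one]

end Record

/-! ## §3. The law on the residual layer; invariance under the pins of record; the headline face from the leaf -/

section Layer

variable {F : T4Family} {N : ℕ} [NeZero N]
variable {L : ℝ} {η : ZIdx → ℝ} [Fact (0 < L)] [∀ i, Fact (0 < η i)] {β : ZIdx → Type} [∀ i, Fintype (β i)]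

/-- **THE RESIDUAL LAYER'S REGULARITY DATA READ GAUGES**: member by member (`i = ⟨K, k, _⟩`), the datum `ζ.R i` reads gauges at the member's level `k` on the
geometry `g i`.  A PREDICATE on `(ζ, g)` — not a field of `ResidZ`, not a record key. [cite: Balaban1985Variational, Thm 1 (9)–(10) p.279] -/
def ResidZ.RegSound (ζ : ResidZ F N) (g : ∀ i : ZIdx, RegGeomT F N i.K (ζ.R i)) : Prop :=
  ∀ i : ZIdx, RegReadsGauge i.k (ζ.R i) (g i)

omit [NeZero N] in
/-- The law is INVARIANT under g2's Sect. E presentation (`withSectE` leaves `R` unchanged, `rfl`). [cite: Balaban1985Variational, (9)–(10) p.279 (bookkeeping)] -/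
theorem ResidZ.regSound_withSectE_iff (ζ : ResidZ F N) (E : SectEPres F N L η β ζ) (g : ∀ i : ZIdx, RegGeomT F N i.K (ζ.R i)) :
    (ζ.withSectE E).RegSound g ↔ ζ.RegSound g := Iff.rfl

/-- The law is INVARIANT under n07-e's criticality pin (`pinCrit` leaves `R` unchanged, `rfl`). [cite: Balaban1985Variational, (9)–(10) p.279 (bookkeeping)] -/
theorem ResidZ.regSound_pinCrit_iff (ζ : ResidZ F N) (g : ∀ i : ZIdx, RegGeomT F N i.K (ζ.R i)) : ζ.pinCrit.RegSound g ↔ ζ.RegSound g := Iff.rfl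

/-- So a law-abiding layer stays law-abiding at the DOUBLY-PINNED layer `(ζ.withSectE E).pinCrit` the N07 closers of record read
(`BalabanUVNodesN07AtRecordCritPinned`). [cite: Balaban1985Variational, (9)–(10) p.279 (bookkeeping)] -/
theorem ResidZ.RegSound.withSectE_pinCrit {ζ : ResidZ F N} {g : ∀ i : ZIdx, RegGeomT F N i.K (ζ.R i)} (hs : ζ.RegSound g) (E : SectEPres F N L η β ζ) :
    (ζ.withSectE E).pinCrit.RegSound g :=
  hs

omit [NeZero N] in
/-- A layer whose data never say «gauged» is law-abiding vacuously, on any geometry. [cite: Balaban1985Variational, (9)–(10) p.279 (bookkeeping)] -/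
theorem ResidZ.regSound_of_not_gauged (ζ : ResidZ F N) (g : ∀ i : ZIdx, RegGeomT F N i.K (ζ.R i)) (h : ∀ i U c, ¬ (ζ.R i).Gauged U c) :
    ζ.RegSound g :=
  fun i => regReadsGauge_of_not_gauged i.k _ (h i)

/-- ★★ **HEADLINE — AT A LAW-ABIDING RESIDUAL LAYER THE LEAF GIVES THEOREM 1's (9)–(10) AS PRINTED (∃u-form) AT NODE 00's OBJECTS**: for every member
`i = ⟨K, k, _⟩`, every `0 < ε₁ ≤ a₁`, every `V` with (7), every minimal configuration `U` of (5) over `𝔘_k(B₃ε₁) ∩ 𝔅_k(V)` (`IsBackground` for the averaging of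
record) and every cube `□` with size parameter `M ≤ M(ε₁)`: there is a gauge `u` of unitary type on `□` with `Uᵘ = e^{iηA}` and `|A| < B₃Mε₁ξ⁻¹`,
`|∇^η A| < B₃Mε₁ξ⁻²`, Hölder `< B₄Mε₁ξ^{-(2+β)}` (`0 ≤ β ≤ 1`), `|∂^{η*}∂^η A|, |Δ^η A| < B₃Mε₁ξ⁻³`, `ξ = Lʲη` — `CarriersZ.exists_thm1At_of_b11Leaf_Z11OfRecord` and
§2's soundness face. [cite: Balaban1985Variational, Thm 1 pp.278–279, (9)–(10)] -/
theorem reg910T_of_b11Leaf_of_regSound {ζ : ResidZ F N} {g : ∀ i : ZIdx, RegGeomT F N i.K (ζ.R i)} (hs : ζ.RegSound g)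
    (h : B11Leaf (Z11OfRecord F N ζ)) :
    ∃ C : B11Thm1.Consts, ∀ (i : ZIdx) (ε₁ : ℝ), 0 < ε₁ → ε₁ ≤ C.a₁ → ∀ V : GaugeField (F.P i.K) i.k (SU N), PlaqSmall ε₁ V →
      ∀ U : GaugeField (F.P i.K) 0 (SU N), IsBackground (avOfRecord F N i.K) {U | InUkClassB11 F N i.K i.k (C.B₃ * ε₁) U} i.k V U →
        ∀ c : (ζ.R i).Cube, (ζ.R i).sizeM c ≤ C.Mfun ε₁ →
          Reg910T F N i.K i.k U ((g i).carrier c) ((ζ.R i).scale c) (g i).dist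
            (C.B₃ * (ζ.R i).sizeM c * ε₁) (C.B₄ * (ζ.R i).sizeM c * ε₁) 1 := by
  obtain ⟨C, hC⟩ := exists_thm1At_of_b11Leaf_Z11OfRecord h
  refine ⟨C, fun i ε₁ h₁ h₂ V hV U hU c hc => ?_⟩
  obtain ⟨-, -, h910⟩ := hC i ε₁ h₁ h₂ V hV
  exact reg910T_of_regularity (hs i) (h910 U hU c hc)

/-- The headline at the DOUBLY-PINNED layer of the N07 closers: the leaf at `Z11OfRecord F N ((ζ.withSectE E).pinCrit)` and the law at `ζ` give (9)–(10) as
printed for the (unchanged) regularity data `ζ.R`. [cite: Balaban1985Variational, Thm 1 pp.278–279, (9)–(10) (bookkeeping)] -/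
theorem reg910T_of_b11Leaf_withSectE_pinCrit_of_regSound {ζ : ResidZ F N} {g : ∀ i : ZIdx, RegGeomT F N i.K (ζ.R i)} (hs : ζ.RegSound g)
    (E : SectEPres F N L η β ζ) (h : B11Leaf (Z11OfRecord F N (ζ.withSectE E).pinCrit)) :
    ∃ C : B11Thm1.Consts, ∀ (i : ZIdx) (ε₁ : ℝ), 0 < ε₁ → ε₁ ≤ C.a₁ → ∀ V : GaugeField (F.P i.K) i.k (SU N), PlaqSmall ε₁ V →
      ∀ U : GaugeField (F.P i.K) 0 (SU N), IsBackground (avOfRecord F N i.K) {U | InUkClassB11 F N i.K i.k (C.B₃ * ε₁) U} i.k V U →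
        ∀ c : (ζ.R i).Cube, (ζ.R i).sizeM c ≤ C.Mfun ε₁ →
          Reg910T F N i.K i.k U ((g i).carrier c) ((ζ.R i).scale c) (g i).dist
            (C.B₃ * (ζ.R i).sizeM c * ε₁) (C.B₄ * (ζ.R i).sizeM c * ε₁) 1 :=
  reg910T_of_b11Leaf_of_regSound (ζ := (ζ.withSectE E).pinCrit) (hs.withSectE_pinCrit E) h

variable (F N) in
/-- **HONESTY — THE LAW DOES NOT CLOSE THE JUNK CHANNEL**: a residual layer whose regularity data NEVER say «gauged» (one cube of size parameter `0` per member,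
constants `0`) is law-abiding (vacuously) and STILL makes the leaf fail through its conjunct `t1` (Theorem 1 at the member `K = k = 0`, `V := 1`, n07-a's
`reg7_one`) — the witness of `CarriersZ.exists_residZ_not_b11Leaf` verbatim.  Closing the channel is the COMPLETENESS half of F8 (a gauge-fixed pin), not this
module. [cite: Balaban1985Variational, Thm 1 (9)–(10) p.279 (bookkeeping: the typed regularity clause reads the residual data)] -/
theorem exists_regSound_not_b11Leaf :
    ∃ (ζ : ResidZ F N) (g : ∀ i : ZIdx, RegGeomT F N i.K (ζ.R i)), ζ.RegSound g ∧ ¬ B11Leaf (Z11OfRecord F N ζ) := by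
  let Plg : B11.LGData :=
    ⟨PUnit, PUnit, PUnit, PUnit, PUnit, PUnit, PUnit, 0, 0, 0, fun _ => 0, fun _ => 0, fun _ _ => 0, fun _ _ _ _ => True,
      fun _ _ _ _ => True, fun _ _ _ => True, fun _ _ _ _ => True, fun _ _ _ => True, fun _ _ => True, fun _ _ _ => PUnit.unit,
      fun _ _ _ => True, fun _ _ => 0, fun _ _ => True, fun _ A => A, fun _ _ => 0, fun _ _ _ _ => 0, fun _ _ => 0, fun _ _ => 0,
      fun _ _ => True, fun _ _ _ => True, fun _ _ _ => PUnit.unit, fun _ _ _ => True, fun _ _ _ => True, fun _ _ _ => True⟩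
  let Pa : B11.AnData :=
    ⟨PUnit, PUnit, PUnit, 0, 0, 0, fun _ => 0, fun _ _ => 0, fun _ _ => True, fun _ => 0, fun _ _ => True, fun _ _ => True,
      fun _ _ => True, fun _ _ => True, fun _ _ _ => True, fun _ _ _ _ _ _ => 0⟩
  let Rbad : ∀ K : ℕ, RegCarrierT F N K := fun _ =>
    ⟨PUnit, fun _ => 0, fun _ => 0, fun _ _ => False, fun _ _ => 0, fun _ _ => 0, fun _ _ _ => 0, fun _ _ => 0⟩
  let ζ : ResidZ F N := ⟨fun i => Rbad i.K, fun _ _ _ => True, fun _ => Plg, fun _ => Pa, 0, 0, 0, 0, 0, 0, 0, 0, 0, 0, 0, 0⟩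
  refine ⟨ζ, fun i => ⟨fun _ => ∅, fun _ _ => 0⟩, ζ.regSound_of_not_gauged _ (fun _ _ _ h => h), fun hZ => ?_⟩
  obtain ⟨C, hC⟩ := exists_thm1At_of_b11Leaf_Z11OfRecord hZ
  obtain ⟨h8, -, h910⟩ :=
    hC ⟨0, 0, le_rfl⟩ C.a₁ C.a₁_pos le_rfl (1 : GaugeField (F.P 0) 0 (SU N)) (B11Thm1CarrierT.reg7_one (Rbad 0) C.a₁_pos)
  obtain ⟨U, -, -, hU⟩ := h8
  exact (h910 U hU PUnit.unit (C.Mfun_pos C.a₁ C.a₁_pos).le).1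

end Layer

end Literature.MathematicalPhysics.QuantumFieldTheory.Balaban1983to89.Node00
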